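import Summits.BirchSwinnertonDyer.Rank1Residual.AdditivePotMult.LeadingCoeffMul
import Literature.NumberTheory.EllipticCurves.Rank1Residual.Typed.Basic
import Literature.NumberTheory.EllipticCurves.BSDQuadraticDescent
import Literature.NumberTheory.EllipticCurves.BSDInvariantsPositivityProofs
import Literature.NumberTheory.EllipticCurves.LFunctionSmulProofs
import HarnessLib

/-!
# X3/X4 at an additive, potentially multiplicative prime: BASE-CHANGE-AND-DESCEND (statements +
# the kernel descent theorem)

HONEST FRAMING (cell `b2b-bsdres`, run/shared/lean/b2b/bsd-rank1-residual/, verbatim in every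
file): the goal of the cell is to DELETE the COMBINATION-SHAPED residual classes of the
Birch–Swinnerton-Dyer formula for ALL analytic-rank `≤ 1` elliptic curves over `ℚ` — "full BSD
formula for every rank `≤ 1` curve in class `C`" assembled STRICTLY from published theorems — so
that the rank-`≤ 1` remainder becomes exactly the CONSTRUCTION-SHAPED classes, which are TYPED
(missing-input `Prop`s), NOT attempted. This is not "finishing BSD". Sub-cell
`b2b-bsdres-additive-p1` (human GO 2026-08-19T21:53Z, CLASS-OWNERS row "X3/X4 additive — pot.
multiplicative / X3♯(M)"): a RESEARCH ROUTE; no claim beyond the stated sub-classes.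

## The sub-classes (exact predicates, `Rank1Residual.Predicates` vocabulary)

`PotMult W p := Addv W p ∧ ord_p j(E) < 0` — additive, POTENTIALLY MULTIPLICATIVE reduction at `p`
(Silverman *AEC* VII.5.5: potentially multiplicative iff `j` is not `p`-integral; the census bit
"engine A: `v_p(j) < 0`" of hyp's SHARPENED-CONJECTURES §3, two-engine 2392/2392).
`ClassX3M W p := ClassX3 W p ∧ PotMult W p ∧ p ≠ 2` = the sharpened sub-statement **X3♯(M)** (tame,
potentially multiplicative; 517 ‖ 298 pairs `N < 2·10⁴ ‖ N < 10⁴` by hyp gen 2);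
`ClassX4M W p := ClassX4 W p ∧ PotMult W p` (X4 is odd `p` by definition).
CM curves never occur (potentially multiplicative ⇒ `j ∉ ℤ` ⇒ no CM), and `p` is odd.

## The route, and what this file proves

At such `(E, p)`, `E` is the twist of a curve with MULTIPLICATIVE reduction at `p` by a quadratic
character ramified at `p`: for `K = ℚ(√D)` quadratic with `p` ramified (`p ∣ D`), `E_K` has
multiplicative reduction at the prime `𝔭`, `𝔭² = (p)`, above `p`, and the twist `E^{(D)}` is
multiplicative at `p` (tree, PROVED: `exists_hasMultiplicativeReductionAt_quadraticTwist_of_one_lt_valuation_j`,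
Silverman *ATAEC* V.5.3; see `AdditivePotMult/Twist.lean`). Artin formalism
`L(E_K,s) = L(E,s)·L(E^{(D)},s)` (tree, proved) and Milne's theorem on the Weil restriction
`Res_{K/ℚ}E_K ∼ E × E^{(D)}` (Invent. Math. 17 (1972) Thm. 1, in Dokchitser–Dokchitser's quotient
form; the tree's named fact `WeierstrassCurve.bsdRHS_baseChange_quadratic` is its rank-0 imaginary
case; the general-rank form is filed as `Literature.NumberTheory.EllipticCurves.Milne1972.bsdQuotient_baseChange_quadratic`)
give the EXACT identity of analytic orders of `Ш` (Miller's currency, over `K` and over `ℚ`):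

  `#Ш_an(E_K/K) / #Ш(E_K/K) = [#Ш_an(E/ℚ)/#Ш(E/ℚ)] · [#Ш_an(E^{(D)}/ℚ)/#Ш(E^{(D)}/ℚ)]`   (★)

(`shaAnOver_mul_eq`). Hence the **descent theorem** `bsdp_of_pPartOver_of_bsdp_twist`: for ANY
prime `p`, `BSD(E,p) ⇐ [p-part of BSD for E_K over K] ∧ BSD(E^{(D)},p)`, with `E`, `E^{(D)}` of
analytic rank `≤ 1` (Gross–Zagier–Kolyvagin for rank and finiteness). The Weil-restriction identity
enters as the explicit hypothesis `hWR` (an equation between the tree's BSD quantities of the three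
curves), discharged from the Literature named fact in `AdditivePotMult/ClassTheorems.lean`; nothing
unpublished is asserted here.

## What is converted and what is not (the located gap) — see HOME/b2b-bsdres-additive-p1/REPORT.md

The conversion RELOCATES the missing input of X3♯(M)/X4(M) to
`MissingPPartOverAt W' p` := "`#Ш_an(E_K/K)` is a rational `q` with `ord_p q = ord_p #Ш(E_K/K)`" for
a curve `E_K` that is SEMISTABLE (multiplicative) at the prime above `p` — the setting in which every
published `p`-part technique lives — plus `BSD(E^{(D)},p)` at a MULTIPLICATIVE prime, which the
partition routes to Covered (Skinner 2016 Thm. C: `r = 0`, irr, ram) / X11 / X2. Presearch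
(2026-08-19, corpus fts+vec and galaxy): NO published theorem reaches the relocated input, because
`p` RAMIFIES in `K`: Wan, Forum Math. Sigma 3 (2015) e18, §1.1 "F a totally real number field where
p is unramified" (and Thm. 7: good ordinary at all primes above `p`; only one divisibility over
`F ≠ ℚ`: "we are unable to prove the main conjecture over F due to the lack of analogs of results of
Kato"); Disegni, Algebra Number Theory 9 (2015) Thm. 3 (good ordinary `p` "decomposing into
principal prime ideals", CONDITIONAL on the cyclotomic IMC over `F`) and Thm. 4 (CM only,
`p ∤ 6h⁻D_F`); Heegner/BDP-type `p`-part results over imaginary quadratic `K` need `p` split in `K`.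
Equivalently (Delbourgo, Compositio Math. 113 (1998), hypothesis (M), Thm. 2, Thm. 3, Prop. 4,
"Main Conjecture" p. 151): the missing object is the `ε = ω^{(p-1)/2}`-branch of the cyclotomic main
conjecture over `ℚ(μ_{p^∞})` for the `p`-multiplicative twist `E^{(p*)}`, with its control / leading
term (in print only the rank-0 algebraic leading term at NON-split `𝔭`, Delbourgo Thm. 3 / Prop. 4).
So BOTH sub-classes stay CONSTRUCTION-SHAPED; this file makes the missing input a first-class,
kernel-checked target and proves that it (with the twist's `BSD_p`) suffices.
-/

noncomputable section

open scoped Classical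

open WeierstrassCurve Literature.NumberTheory.EllipticCurves
  Literature.NumberTheory.EllipticCurves.Rank1Residual
  Literature.NumberTheory.EllipticCurves.Rank1Residual.Typed

namespace Summit.BirchSwinnertonDyer.Rank1Residual.AdditivePotMult

/-! ## §1 The sub-classes -/

section Classes

variable (W : WeierstrassCurve ℚ) [W.IsElliptic] (p : ℕ) [Fact p.Prime]

/-- **pot-mult(p)**: `E` has additive, POTENTIALLY MULTIPLICATIVE reduction at `p`: additive
(`Addv`: neither good nor multiplicative) and `ord_p j(E) < 0` (Silverman, *AEC* VII.5.5: `E` has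
potential good reduction iff `j` is integral at `p`; otherwise — *AEC* VII.5.4(c), *ATAEC* V.5.3 —
`E` is a ramified quadratic twist of a Tate curve). The census bit of hyp's SHARPENED-CONJECTURES
§3 ("(M) potentially multiplicative ⇔ `v_p(j) < 0`"). [folklore] -/
def PotMult : Prop := Addv W p ∧ padicValRat p W.j < 0

/-- **X3♯(M)** = class X3 (Eisenstein additive: `red(p) ∧ add(p)`) ∧ pot-mult(p) ∧ `p` odd — hyp's
sharpened sub-statement "X3♯(M) tame potentially multiplicative (517 ‖ 298 pairs)", CLASS-OWNERS
row `b2b-bsdres-additive-p1`. [folklore] -/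
def ClassX3M [W.IsGloballyMinimal] : Prop := ClassX3 W p ∧ PotMult W p ∧ p ≠ 2

/-- **X4(M)** = class X4 (`p ≠ 2 ∧ add(p) ∧ irr(p)`) ∧ pot-mult(p). [folklore] -/
def ClassX4M : Prop := ClassX4 W p ∧ PotMult W p

omit [W.IsElliptic] in
/-- X3♯(M) pairs are X3 pairs. [folklore] -/
theorem ClassX3M.classX3 [W.IsElliptic] [W.IsGloballyMinimal] (h : ClassX3M W p) : ClassX3 W p := h.1

/-- X3♯(M) pairs are potentially multiplicative at `p`. [folklore] -/
theorem ClassX3M.potMult [W.IsGloballyMinimal] (h : ClassX3M W p) : PotMult W p := h.2.1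

/-- X3♯(M): `p` is odd. [folklore] -/
theorem ClassX3M.p_ne_two [W.IsGloballyMinimal] (h : ClassX3M W p) : p ≠ 2 := h.2.2

/-- X4(M) pairs are X4 pairs. [folklore] -/
theorem ClassX4M.classX4 (h : ClassX4M W p) : ClassX4 W p := h.1

/-- X4(M) pairs are potentially multiplicative at `p`. [folklore] -/
theorem ClassX4M.potMult (h : ClassX4M W p) : PotMult W p := h.2

/-- X4(M): `p` is odd. [folklore] -/
theorem ClassX4M.p_ne_two (h : ClassX4M W p) : p ≠ 2 := h.1.1

/-- X4(M): `E[p]` is irreducible. [folklore] -/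
theorem ClassX4M.irr (h : ClassX4M W p) : Irr W p := h.1.2.2

/-- A potentially multiplicative prime is not a good prime. [folklore] -/
theorem PotMult.not_good (h : PotMult W p) : ¬ Good W p := h.1.1

/-- A potentially multiplicative prime (in the additive sense of this file) is not multiplicative. [folklore] -/
theorem PotMult.not_mult (h : PotMult W p) : ¬ Mult W p := h.1.2

end Classes

/-! ## §2 The analytic order of `Ш` over a number field and the TYPED over-`K` input -/

section OverK

variable {K : Type*} [Field K] [NumberField K]

/-- **The analytic order of `Ш` over a number field**, Miller's currency transported to `K`:
`#Ш(E/K)_an := L^{(r)}(E_K,1)/r! · #E(K)_tors² / (Ω(E_K/K) · ∏_w c_w · Reg(E_K/K))`, i.e. the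
Birch–Swinnerton-Dyer formula over `K` (Dokchitser–Dokchitser 2010 Conj. 2.1; Tate, Sém. Bourbaki
306) solved for `#Ш`, on a model `W'` whose differential is Néron at every finite place (e.g.
globally minimal): `Ω = W'.bsdPeriod` (`∏_{w∣∞} ∫|ω|_w / |d_K|^{1/2}`, `ComplexPeriod.lean`),
`Reg = W'.regulator` (canonical height relative to `K`, `Heights.lean`). For `K = ℚ` it is the
tree's `shaAn` (`shaAnOver_eq_shaAn`). A complex number (the leading coefficient is one). [folklore] -/
def shaAnOver (W' : WeierstrassCurve K) : ℂ :=
  W'.leadingLCoeff * (W'.torsionOrder : ℂ) ^ 2 /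
    ((W'.bsdPeriod : ℂ) * (W'.tamagawaProduct : ℂ) * (W'.regulator : ℂ))

/-- **The TYPED over-`K` input at `(E_K, p)`** (the RELOCATED missing input of X3♯(M)/X4(M)): the
`p`-part of the Birch–Swinnerton-Dyer formula for the curve `W'` over the number field `K`, in
Miller's currency — "`#Ш(W'/K)_an` is a rational `q` with `ord_p q = ord_p #Ш(W'/K)`" (`p` the
rational prime; all primes of `K` above `p` at once). A predicate; NOTHING asserted. In the route,
`W'` is a globally minimal `K`-model of `E_K`, `K = ℚ(√D)` ramified at `p`, so `E_K` is
MULTIPLICATIVE at the unique prime above `p` (ramification index 2): no published theorem reaches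
this (module docstring: Wan 2015 §1.1 needs `p` unramified in `F`; Disegni 2015 Thm. 3/4 need good
ordinary `p` and are conditional / CM; anticyclotomic results need `p` split) — the located gap.
[folklore] -/
def MissingPPartOverAt (W' : WeierstrassCurve K) (p : ℕ) : Prop :=
  ∃ q : ℚ, shaAnOver W' = (q : ℂ) ∧ padicValRat p q = padicValNat p W'.shaOrder

/-- Over `ℚ` the analytic order of `Ш` of this file is the tree's `shaAn` (the BSD period of a
model over the number field `ℚ` is its real period, `bsdPeriod_eq_realPeriod_baseChange`). [folklore] -/
theorem shaAnOver_eq_shaAn (W : WeierstrassCurve ℚ) : shaAnOver W = shaAn W := by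
  rw [shaAnOver, shaAn_def, bsdPeriod_eq_realPeriod_baseChange, realPeriodRat]

/-- Hence over `ℚ` the typed over-`K` input is the cell's `MissingPPartAt`. [folklore] -/
theorem missingPPartOverAt_rat_iff (W : WeierstrassCurve ℚ) (p : ℕ) :
    MissingPPartOverAt W p ↔ MissingPPartAt W p := by
  simp only [MissingPPartOverAt, MissingPPartAt, shaAnOver_eq_shaAn]

end OverK

/-! ## §3 The identity (★) and the descent theorem -/

section Descent

variable (W : WeierstrassCurve ℚ) [W.IsElliptic] (p : ℕ) [Fact p.Prime]
  (K : Type) [Field K] [NumberField K]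
  (Wd : WeierstrassCurve ℚ) [Wd.IsElliptic] (W' : WeierstrassCurve K) [W'.IsElliptic]

/-! The theorems of this section hold for every model `W` (Miller's `BSD(E,p)` and `#Ш_an` are
defined for any Weierstrass model); they are the BSD quantities exactly when `W`, `Wd`, `W'` are
globally minimal, which is how `ClassTheorems.lean` applies them. -/

/-- **`L^*(E_K,1) = L^*(E,1) · L^*(E^{(D)},1)` on the chosen models**: `W'` a `K`-model of
`W.baseChange K`, `Wd` a `ℚ`-model of the twist by `d_K` (leading coefficients are model
invariants, `leadingLCoeff_smul`; Artin formalism, `leadingLCoeff_baseChange_quadratic`). [folklore] -/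
theorem leadingLCoeff_models_eq (hmod : hasEntireLFunction_rat) (h2 : Module.finrank ℚ K = 2)
    (hWd : ∃ C : VariableChange ℚ, C • W.quadraticTwist (NumberField.discr K : ℚ) = Wd)
    (hW' : ∃ C : VariableChange K, C • W.baseChange K = W') :
    W'.leadingLCoeff = W.leadingLCoeff * Wd.leadingLCoeff := by
  obtain ⟨C, rfl⟩ := hW'
  obtain ⟨Cd, rfl⟩ := hWd
  have hD : (NumberField.discr K : ℚ) ≠ 0 := by exact_mod_cast NumberField.discr_ne_zero K
  haveI := W.isElliptic_quadraticTwist hD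
  haveI : (W.baseChange K).IsElliptic := by rw [baseChange]; infer_instance
  rw [leadingLCoeff_smul, leadingLCoeff_smul, leadingLCoeff_baseChange_quadratic W K hmod h2]

omit [Fact p.Prime] in
/-- **The identity (★) of analytic orders of `Ш`** (Milne's Weil-restriction identity `hWR` +
Artin formalism): with `B = RHS(W)·RHS(Wd) > 0`,
`#Ш_an(W')·#Ш(W)·#Ш(Wd) = #Ш_an(W)·#Ш_an(Wd)·#Ш(W')` as complex numbers. All three `Ш` finite.
[folklore] -/
theorem shaAnOver_mul_eq (hmod : hasEntireLFunction_rat) (h2 : Module.finrank ℚ K = 2)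
    (hWd : ∃ C : VariableChange ℚ, C • W.quadraticTwist (NumberField.discr K : ℚ) = Wd)
    (hW' : ∃ C : VariableChange K, C • W.baseChange K = W')
    (hshaW : W.ShaFinite) (hshaD : Wd.ShaFinite) (hshaK : W'.ShaFinite)
    (hWR : (W'.shaOrder : ℝ) * W'.regulator * W'.bsdPeriod * (W'.tamagawaProduct : ℝ) /
        (W'.torsionOrder : ℝ) ^ 2 = W.bsdRHS * Wd.bsdRHS) :
    shaAnOver W' * (W.shaOrder : ℂ) * (Wd.shaOrder : ℂ) =
      shaAn W * shaAn Wd * (W'.shaOrder : ℂ) := by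
  -- positivity over `ℚ`
  have hBW : 0 < W.bsdRHS := W.bsdRHS_pos' hshaW
  have hBD : 0 < Wd.bsdRHS := Wd.bsdRHS_pos' hshaD
  have hB : 0 < W.bsdRHS * Wd.bsdRHS := mul_pos hBW hBD
  have hsW : (0 : ℝ) < W.shaOrder := Nat.cast_pos.mpr (W.shaOrder_pos hshaW)
  have hsD : (0 : ℝ) < Wd.shaOrder := Nat.cast_pos.mpr (Wd.shaOrder_pos hshaD)
  have hsK : (0 : ℝ) < W'.shaOrder := Nat.cast_pos.mpr (W'.shaOrder_pos hshaK)
  have hRW : (0 : ℝ) < W.regulator := W.regulator_pos'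
  have hRD : (0 : ℝ) < Wd.regulator := Wd.regulator_pos'
  have hΩW : (0 : ℝ) < W.realPeriodRat := W.realPeriodRat_pos_holds
  have hΩD : (0 : ℝ) < Wd.realPeriodRat := Wd.realPeriodRat_pos_holds
  have hcW : (0 : ℝ) < W.tamagawaProduct := Nat.cast_pos.mpr W.tamagawaProduct_pos_holds
  have hcD : (0 : ℝ) < Wd.tamagawaProduct := Nat.cast_pos.mpr Wd.tamagawaProduct_pos_holds
  have htW : (0 : ℝ) < W.torsionOrder := Nat.cast_pos.mpr W.torsionOrder_pos_holds
  have htD : (0 : ℝ) < Wd.torsionOrder := Nat.cast_pos.mpr Wd.torsionOrder_pos_holds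
  -- non-vanishing over `K`, read off Milne's identity
  have htK : (W'.torsionOrder : ℝ) ≠ 0 := by
    intro h0
    rw [h0, zero_pow two_ne_zero, div_zero] at hWR
    exact hB.ne hWR
  have hRK : W'.regulator ≠ 0 := by
    intro h0
    rw [h0, mul_zero, zero_mul, zero_mul, zero_div] at hWR
    exact hB.ne hWR
  have hΩK : W'.bsdPeriod ≠ 0 := by
    intro h0
    rw [h0, mul_zero, zero_mul, zero_div] at hWR
    exact hB.ne hWR
  have hcK : (W'.tamagawaProduct : ℝ) ≠ 0 := by
    intro h0
    rw [h0, mul_zero, zero_div] at hWR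
    exact hB.ne hWR
  -- pass to `ℂ`
  have hL := leadingLCoeff_models_eq W K Wd W' hmod h2 hWd hW'
  have hWR' : ((W'.shaOrder : ℝ) : ℂ) * (W'.regulator : ℂ) * (W'.bsdPeriod : ℂ) *
      ((W'.tamagawaProduct : ℝ) : ℂ) / ((W'.torsionOrder : ℝ) : ℂ) ^ 2 =
      (W.bsdRHS : ℂ) * (Wd.bsdRHS : ℂ) := by
    exact_mod_cast congrArg (fun x : ℝ => (x : ℂ)) hWR
  rw [shaAnOver, shaAn_def, shaAn_def, hL]
  rw [bsdRHS_def, bsdRHS_def] at hWR'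
  push_cast at hWR' ⊢
  have htK' : (W'.torsionOrder : ℂ) ≠ 0 := by exact_mod_cast htK
  have hRK' : (W'.regulator : ℂ) ≠ 0 := by exact_mod_cast hRK
  have hΩK' : (W'.bsdPeriod : ℂ) ≠ 0 := by exact_mod_cast hΩK
  have hcK' : (W'.tamagawaProduct : ℂ) ≠ 0 := by exact_mod_cast hcK
  have hRW' : (W.regulator : ℂ) ≠ 0 := by exact_mod_cast hRW.ne'
  have hRD' : (Wd.regulator : ℂ) ≠ 0 := by exact_mod_cast hRD.ne'
  have hΩW' : (W.realPeriodRat : ℂ) ≠ 0 := by exact_mod_cast hΩW.ne'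
  have hΩD' : (Wd.realPeriodRat : ℂ) ≠ 0 := by exact_mod_cast hΩD.ne'
  have hcW' : (W.tamagawaProduct : ℂ) ≠ 0 := by exact_mod_cast hcW.ne'
  have hcD' : (Wd.tamagawaProduct : ℂ) ≠ 0 := by exact_mod_cast hcD.ne'
  have htW' : (W.torsionOrder : ℂ) ≠ 0 := by exact_mod_cast htW.ne'
  have htD' : (Wd.torsionOrder : ℂ) ≠ 0 := by exact_mod_cast htD.ne'
  field_simp
  field_simp at hWR'
  -- both sides are polynomial identities modulo `hWR'`
  linear_combination (-(W.leadingLCoeff * Wd.leadingLCoeff)) * hWR'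

/-- **DESCENT THEOREM (base-change-and-descend, any prime `p`).** Let `W/ℚ` be globally minimal
of analytic rank `≤ 1`, `K` a quadratic field, `Wd` a globally minimal model of the twist
`W^{(d_K)}` of analytic rank `≤ 1`, and `W'` a globally minimal `K`-model of `W_K` with `Ш(W'/K)`
finite and Milne's Weil-restriction identity `hWR` (`BSD(E_K/K) = RHS(W)·RHS(Wd)`; the Literature
named fact `Milne1972.bsdQuotient_baseChange_quadratic` supplies both). THEN the typed over-`K`
input `MissingPPartOverAt W' p` together with `BSD(Wd, p)` implies Miller's `BSD(W, p)`.
Proof: (★) `shaAnOver_mul_eq`, rationality and `ord_p` bookkeeping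
(`ord_p #Ш_an(W) = ord_p q' + ord_p #Ш(W) + ord_p #Ш(Wd) − ord_p #Ш(W') − ord_p #Ш_an(Wd) = ord_p #Ш(W)`),
Gross–Zagier–Kolyvagin (`hGZK`) for ranks and finiteness over `ℚ`, modularity (`hmod`) for
`L^*(Wd) ≠ 0`. Inputs beyond the two displayed hypotheses are the cell's standard named facts.
[folklore] -/
theorem bsdp_of_pPartOver_of_bsdp_twist
    (hGZK : rank_eq_analyticRank_of_analyticRank_le_one) (hmod : hasEntireLFunction_rat)
    (hr : W.analyticRank ≤ 1) (h2 : Module.finrank ℚ K = 2)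
    (hWd : ∃ C : VariableChange ℚ, C • W.quadraticTwist (NumberField.discr K : ℚ) = Wd)
    (hrd : Wd.analyticRank ≤ 1)
    (hW' : ∃ C : VariableChange K, C • W.baseChange K = W') (hshaK : W'.ShaFinite)
    (hWR : (W'.shaOrder : ℝ) * W'.regulator * W'.bsdPeriod * (W'.tamagawaProduct : ℝ) /
        (W'.torsionOrder : ℝ) ^ 2 = W.bsdRHS * Wd.bsdRHS)
    (hK : MissingPPartOverAt W' p) (hd : BSDp Wd p) : BSDp W p := by
  obtain ⟨-, hfinW⟩ := hGZK W hr
  obtain ⟨-, hfinD⟩ := hGZK Wd hrd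
  haveI : Finite W.sha := hfinW
  haveI : Finite Wd.sha := hfinD
  -- the two inputs, in Miller's currency
  obtain ⟨qd, hqd, hvd⟩ := missingPPartAt_of_bsdp Wd p hd
  obtain ⟨q', hq', hv'⟩ := hK
  -- (★)
  have hstar := shaAnOver_mul_eq W K Wd W' hmod h2 hWd hW' hfinW hfinD hshaK hWR
  -- non-vanishing
  have hsW : W.shaOrder ≠ 0 := (W.shaOrder_pos hfinW).ne'
  have hsD : Wd.shaOrder ≠ 0 := (Wd.shaOrder_pos hfinD).ne'
  have hsK : W'.shaOrder ≠ 0 := (W'.shaOrder_pos hshaK).ne'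
  have hqd0 : qd ≠ 0 := by
    intro h0
    rw [h0, Rat.cast_zero, shaAn_def, div_eq_zero_iff] at hqd
    rcases hqd with h | h
    · rcases mul_eq_zero.mp h with h | h
      · exact Wd.leadingLCoeff_ne_zero_holds (hmod Wd) h
      · exact (pow_ne_zero 2 (by exact_mod_cast Wd.torsionOrder_pos_holds.ne' :
          (Wd.torsionOrder : ℂ) ≠ 0)) h
    · rcases mul_eq_zero.mp h with h | h
      · rcases mul_eq_zero.mp h with h | h
        · exact (by exact_mod_cast Wd.realPeriodRat_pos_holds.ne' : (Wd.realPeriodRat : ℂ) ≠ 0) h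
        · exact (by exact_mod_cast Wd.tamagawaProduct_pos_holds.ne' :
            (Wd.tamagawaProduct : ℂ) ≠ 0) h
      · exact (by exact_mod_cast Wd.regulator_pos'.ne' : (Wd.regulator : ℂ) ≠ 0) h
  -- solve (★) for `#Ш_an(W)`
  set q : ℚ := q' * W.shaOrder * Wd.shaOrder / (W'.shaOrder * qd) with hq_def
  have hshaAn : shaAn W = (q : ℂ) := by
    have hden : (W'.shaOrder : ℂ) * (qd : ℂ) ≠ 0 :=
      mul_ne_zero (by exact_mod_cast hsK) (by exact_mod_cast hqd0)
    rw [hq_def]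
    push_cast
    rw [eq_div_iff hden, ← hqd, ← hq']
    linear_combination -hstar
  refine bsdp_of_missingPPartAt W p hGZK hr ⟨q, hshaAn, ?_⟩
  -- valuations
  have hq'0 : q' ≠ 0 := by
    intro h0
    apply hqd0
    have : shaAn W * shaAn Wd * (W'.shaOrder : ℂ) = 0 := by
      rw [← hstar, hq', h0]; simp
    rw [hqd] at this
    rcases mul_eq_zero.mp this with h | h
    · rcases mul_eq_zero.mp h with h | h
      · -- then `shaAn W = 0`, and `q = 0`; but `q' = 0` already decides: use `hvd`/`hv'` — simpler:
        -- `shaAn W = 0` forces `L^*(W) = 0`, impossible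
        exfalso
        rw [shaAn_def, div_eq_zero_iff] at h
        rcases h with h | h
        · rcases mul_eq_zero.mp h with h | h
          · exact W.leadingLCoeff_ne_zero_holds (hmod W) h
          · exact (pow_ne_zero 2 (by exact_mod_cast W.torsionOrder_pos_holds.ne' :
              (W.torsionOrder : ℂ) ≠ 0)) h
        · rcases mul_eq_zero.mp h with h | h
          · rcases mul_eq_zero.mp h with h | h
            · exact (by exact_mod_cast W.realPeriodRat_pos_holds.ne' : (W.realPeriodRat : ℂ) ≠ 0) h
            · exact (by exact_mod_cast W.tamagawaProduct_pos_holds.ne' :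
                (W.tamagawaProduct : ℂ) ≠ 0) h
          · exact (by exact_mod_cast W.regulator_pos'.ne' : (W.regulator : ℂ) ≠ 0) h
      · exact_mod_cast h
    · exact absurd (by exact_mod_cast h : W'.shaOrder = 0) hsK
  have hsWq : (W.shaOrder : ℚ) ≠ 0 := by exact_mod_cast hsW
  have hsDq : (Wd.shaOrder : ℚ) ≠ 0 := by exact_mod_cast hsD
  have hsKq : (W'.shaOrder : ℚ) ≠ 0 := by exact_mod_cast hsK
  rw [hq_def, padicValRat.div (mul_ne_zero (mul_ne_zero hq'0 hsWq) hsDq) (mul_ne_zero hsKq hqd0),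
    padicValRat.mul (mul_ne_zero hq'0 hsWq) hsDq, padicValRat.mul hq'0 hsWq,
    padicValRat.mul hsKq hqd0, hv', hvd, padicValRat.of_nat, padicValRat.of_nat, padicValRat.of_nat]
  ring

end Descent

end Summit.BirchSwinnertonDyer.Rank1Residual.AdditivePotMult

end
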